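import Literature.MathematicalPhysics.QuantumLattice.FreeFermiGasPairGramBounds
import HarnessLib

/-!
# No `d`-wave pair long-range order without a smeared momentum distribution

Family `hubbard` / trunk T-QLATTICE. For ANY unit vector `ψ` of the fermionic Fock space of the
torus `(ℤ/Lℤ)²`, write `x_k = ⟨n_{k↑}⟩ ∈ [0,1]` for the occupation of the Bloch mode `(k, ↑)` and
`S(ψ) = Σ_k x_k (1 - x_k)` for the total SMEARING of the momentum distribution (`S = 0` exactly for
the eigenvectors of all `n_{k↑}`, e.g. every plane-wave Slater determinant / free Fermi sea).
The pair Gram bounds of `FreeFermiGasPairGramBounds.lean`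
(`Re ⟨ψ, Δ_d† Δ_d ψ⟩ ≤ 32 L² + 32 (Σ_k t_k)²`, `t_k⁴ = u_k v_k ≤ x_k (1 - x_k)`) and the power-mean
inequality `(Σ_k t_k)⁴ ≤ (L²)³ Σ_k t_k⁴` (Cauchy–Schwarz twice, inlined) give:

* `re_expect_pairField_dWave_le_smearing` — **`Re ⟨ψ, Δ_d† Δ_d ψ⟩ ≤ 32 L² + 32 L³ √S(ψ)`**;
* `smearing_ge_of_pairField_dWave_lro` — the density form: **if `Re ⟨ψ, Δ_d† Δ_d ψ⟩ ≥ a L⁴` and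
  `a L² ≥ 64`, then `S(ψ) ≥ a² L²/4096`**: `d`-wave pair long-range order of density `a` in ANY state
  forces a MACROSCOPIC number (`≥ a² L²/4096` in the quadratic measure `x(1-x) ≤ 1/4`) of partially
  occupied Bloch modes — the BCS `u_k v_k ≠ 0` mechanism as a necessary condition.

Bardeen–Cooper–Schrieffer, Phys. Rev. 108 (1957) 1175, §II (pairing amplitude `u_k v_k`);
C. N. Yang, Rev. Mod. Phys. 34 (1962) 694, §3. Folklore finite-dimensional statements; no named
facts, no definitions.

## Mathlib / tree search

Tree: `re_expect_pairField_dWave_le`, `re_expect_pairPresent_mem_Icc`, `re_expect_pairAbsent_mem_Icc`,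
`re_expect_momentumNumber_mem_Icc`, `card_torusSite`. Mathlib: `sq_sum_le_card_mul_sum_sq`
(Chebyshev / Cauchy–Schwarz against `1`), `abs_le_of_sq_le_sq'`, `Real.sq_sqrt`.
-/

noncomputable section

namespace Literature.MathematicalPhysics.QuantumLattice

open Matrix Finset Literature.Probability.LatticeModels
open scoped ComplexOrder ComplexConjugate

section Smearing

variable {L : ℕ} [NeZero L]

/-- `t_k⁴ = u_k v_k ≤ x_k (1 - x_k)` for a unit vector: the quartic mean of the pair Gram bounds is
dominated by the smearing of the mode `(k, ↑)` (`0 ≤ u_k ≤ x_k`, `0 ≤ v_k ≤ 1 - x_k`). [folklore] -/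
theorem quarticMean_pow_four_le_smearing (k : TorusSite 2 L) (ψ : Fock (Orb (FermionTorus 2 L)))
    (h1 : star ψ ⬝ᵥ ψ = 1) :
    Real.sqrt (Real.sqrt
        ((star ψ ⬝ᵥ ((momentumNumber k 0 * momentumNumber (-k) 1) *ᵥ ψ)).re *
          (star ψ ⬝ᵥ (((1 - momentumNumber k 0) * (1 - momentumNumber (-k) 1)) *ᵥ ψ)).re)) ^ 4 ≤
      (star ψ ⬝ᵥ (momentumNumber k 0 *ᵥ ψ)).re *
        (1 - (star ψ ⬝ᵥ (momentumNumber k 0 *ᵥ ψ)).re) := by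
  have hu := re_expect_pairPresent_mem_Icc k ψ
  have hv := re_expect_pairAbsent_mem_Icc k ψ
  rw [h1, Complex.one_re] at hv
  generalize (star ψ ⬝ᵥ ((momentumNumber k 0 * momentumNumber (-k) 1) *ᵥ ψ)).re = u at *
  generalize (star ψ ⬝ᵥ (((1 - momentumNumber k 0) * (1 - momentumNumber (-k) 1)) *ᵥ ψ)).re = v at *
  generalize (star ψ ⬝ᵥ (momentumNumber k 0 *ᵥ ψ)).re = x at *
  have huv : 0 ≤ u * v := mul_nonneg hu.1 hv.1
  have e : Real.sqrt (Real.sqrt (u * v)) ^ 4 = u * v := by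
    rw [show (4 : ℕ) = 2 * 2 from rfl, pow_mul, Real.sq_sqrt (Real.sqrt_nonneg _),
      Real.sq_sqrt huv]
  rw [e]
  exact mul_le_mul hu.2 hv.2 hv.1 (hu.1.trans hu.2)

/-- **`Re ⟨ψ, Δ_d† Δ_d ψ⟩ ≤ 32 L² + 32 L³ √(Σ_k x_k (1 - x_k))`** for every unit vector `ψ`,
`x_k = Re ⟨ψ, n_{k↑} ψ⟩`: the pair Gram bound `32 L² + 32 (Σ_k t_k)²` and
`(Σ_k t_k)² ≤ √((L²)³ Σ_k t_k⁴) ≤ L³ √(Σ_k x_k(1 - x_k))`. Bardeen–Cooper–Schrieffer (1957) §II;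
Yang (1962) §3. [folklore] -/
theorem re_expect_pairField_dWave_le_smearing (ψ : Fock (Orb (FermionTorus 2 L)))
    (h1 : star ψ ⬝ᵥ ψ = 1) :
    (star ψ ⬝ᵥ (((pairField dWaveFormFactor L)ᴴ * pairField dWaveFormFactor L) *ᵥ ψ)).re ≤
      32 * (L : ℝ) ^ 2 + 32 * (L : ℝ) ^ 3 * Real.sqrt (∑ k : TorusSite 2 L,
        (star ψ ⬝ᵥ (momentumNumber k 0 *ᵥ ψ)).re * (1 - (star ψ ⬝ᵥ (momentumNumber k 0 *ᵥ ψ)).re)) := by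
  have hG := re_expect_pairField_dWave_le ψ h1
  set t : TorusSite 2 L → ℝ := fun k => Real.sqrt (Real.sqrt
        ((star ψ ⬝ᵥ ((momentumNumber k 0 * momentumNumber (-k) 1) *ᵥ ψ)).re *
          (star ψ ⬝ᵥ (((1 - momentumNumber k 0) * (1 - momentumNumber (-k) 1)) *ᵥ ψ)).re)) with ht
  set S : ℝ := ∑ k : TorusSite 2 L,
      (star ψ ⬝ᵥ (momentumNumber k 0 *ᵥ ψ)).re * (1 - (star ψ ⬝ᵥ (momentumNumber k 0 *ᵥ ψ)).re)
    with hS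
  change (star ψ ⬝ᵥ (((pairField dWaveFormFactor L)ᴴ * pairField dWaveFormFactor L) *ᵥ ψ)).re ≤
      32 * (L : ℝ) ^ 2 + 32 * (∑ k, t k) ^ 2 at hG
  -- `(Σ t)⁴ ≤ (L²)³ Σ t⁴ ≤ L⁶ S`
  have hcard : ((Finset.univ : Finset (TorusSite 2 L)).card : ℝ) = (L : ℝ) ^ 2 := by
    rw [Finset.card_univ, card_torusSite]
    push_cast
    ring
  have h4 : (∑ k, t k) ^ 4 ≤ (L : ℝ) ^ 6 * S := by
    -- power mean `(Σ t)⁴ ≤ |Λ*|³ Σ t⁴` (Cauchy–Schwarz against `1`, twice), inlined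
    have h : (∑ k, t k) ^ 4 ≤
        ((Finset.univ : Finset (TorusSite 2 L)).card : ℝ) ^ 3 * ∑ k, t k ^ 4 := by
      have c1 : (∑ k, t k) ^ 2 ≤ ((Finset.univ : Finset (TorusSite 2 L)).card : ℝ) * ∑ k, t k ^ 2 :=
        sq_sum_le_card_mul_sum_sq
      have c2 : (∑ k, t k ^ 2) ^ 2 ≤
          ((Finset.univ : Finset (TorusSite 2 L)).card : ℝ) * ∑ k, (t k ^ 2) ^ 2 :=
        sq_sum_le_card_mul_sum_sq
      have c0 : 0 ≤ (∑ k, t k) ^ 2 := sq_nonneg _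
      have hM : (0 : ℝ) ≤ ((Finset.univ : Finset (TorusSite 2 L)).card : ℝ) := Nat.cast_nonneg _
      generalize ((Finset.univ : Finset (TorusSite 2 L)).card : ℝ) = M at c1 c2 hM ⊢
      have e4 : ∑ k, (t k ^ 2) ^ 2 = ∑ k, t k ^ 4 := Finset.sum_congr rfl fun k _ => by ring
      rw [e4] at c2
      calc (∑ k, t k) ^ 4 = ((∑ k, t k) ^ 2) ^ 2 := by ring
        _ ≤ (M * ∑ k, t k ^ 2) ^ 2 := pow_le_pow_left₀ c0 c1 2
        _ = M ^ 2 * (∑ k, t k ^ 2) ^ 2 := by ring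
        _ ≤ M ^ 2 * (M * ∑ k, t k ^ 4) := mul_le_mul_of_nonneg_left c2 (by positivity)
        _ = M ^ 3 * ∑ k, t k ^ 4 := by ring
    rw [hcard] at h
    have hsum : ∑ k, t k ^ 4 ≤ S := Finset.sum_le_sum fun k _ => quarticMean_pow_four_le_smearing k ψ h1
    calc (∑ k, t k) ^ 4 ≤ ((L : ℝ) ^ 2) ^ 3 * ∑ k, t k ^ 4 := h
      _ ≤ ((L : ℝ) ^ 2) ^ 3 * S := mul_le_mul_of_nonneg_left hsum (by positivity)
      _ = (L : ℝ) ^ 6 * S := by ring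
  have hT0 : 0 ≤ ∑ k, t k := Finset.sum_nonneg fun k _ => Real.sqrt_nonneg _
  have hS0 : 0 ≤ S := Finset.sum_nonneg fun k _ => by
    have hx := re_expect_momentumNumber_mem_Icc k 0 ψ
    rw [h1, Complex.one_re] at hx
    exact mul_nonneg hx.1 (by linarith [hx.2])
  -- `(Σ t)² ≤ L³ √S`
  have h2 : (∑ k, t k) ^ 2 ≤ (L : ℝ) ^ 3 * Real.sqrt S := by
    have hL : (0 : ℝ) ≤ (L : ℝ) ^ 3 := by positivity
    have hsq : ((∑ k, t k) ^ 2) ^ 2 ≤ ((L : ℝ) ^ 3 * Real.sqrt S) ^ 2 := by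
      calc ((∑ k, t k) ^ 2) ^ 2 = (∑ k, t k) ^ 4 := by ring
        _ ≤ (L : ℝ) ^ 6 * S := h4
        _ = ((L : ℝ) ^ 3 * Real.sqrt S) ^ 2 := by
            rw [mul_pow, Real.sq_sqrt hS0]; ring
    exact (abs_le_of_sq_le_sq' hsq (mul_nonneg hL (Real.sqrt_nonneg _))).2
  nlinarith

/-- **Pair LRO forces a macroscopically smeared momentum distribution.** For a unit vector `ψ` with
`d`-wave pair long-range order `a L⁴ ≤ Re ⟨ψ, Δ_d† Δ_d ψ⟩` on a torus with `a L² ≥ 64`: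
`Σ_k x_k (1 - x_k) ≥ a² L²/4096`, `x_k = Re ⟨ψ, n_{k↑} ψ⟩` — at least `a² L²/1024` Bloch modes are
partially occupied (each term is `≤ 1/4`); no state with a sharp momentum distribution (up to
`o(L²)` smeared modes) carries `d`-wave pair LRO. Bardeen–Cooper–Schrieffer (1957) §II; Yang (1962)
§3. [folklore] -/
theorem smearing_ge_of_pairField_dWave_lro (ψ : Fock (Orb (FermionTorus 2 L)))
    (h1 : star ψ ⬝ᵥ ψ = 1) {a : ℝ} (h64 : 64 ≤ a * (L : ℝ) ^ 2)
    (hlro : a * (L : ℝ) ^ 4 ≤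
      (star ψ ⬝ᵥ (((pairField dWaveFormFactor L)ᴴ * pairField dWaveFormFactor L) *ᵥ ψ)).re) :
    a ^ 2 * (L : ℝ) ^ 2 / 4096 ≤ ∑ k : TorusSite 2 L,
      (star ψ ⬝ᵥ (momentumNumber k 0 *ᵥ ψ)).re * (1 - (star ψ ⬝ᵥ (momentumNumber k 0 *ᵥ ψ)).re) := by
  have hmain := hlro.trans (re_expect_pairField_dWave_le_smearing ψ h1)
  set S : ℝ := ∑ k : TorusSite 2 L,
      (star ψ ⬝ᵥ (momentumNumber k 0 *ᵥ ψ)).re * (1 - (star ψ ⬝ᵥ (momentumNumber k 0 *ᵥ ψ)).re)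
    with hS
  have hS0 : 0 ≤ S := Finset.sum_nonneg fun k _ => by
    have hx := re_expect_momentumNumber_mem_Icc k 0 ψ
    rw [h1, Complex.one_re] at hx
    exact mul_nonneg hx.1 (by linarith [hx.2])
  have hL0 : (0 : ℝ) < (L : ℝ) := by exact_mod_cast Nat.pos_of_ne_zero (NeZero.ne L)
  have hL2 : (0 : ℝ) < (L : ℝ) ^ 2 := by positivity
  have hL3 : (0 : ℝ) < (L : ℝ) ^ 3 := by positivity
  have ha0 : 0 < a := by
    by_contra ha
    have : a * (L : ℝ) ^ 2 ≤ 0 := mul_nonpos_of_nonpos_of_nonneg (not_lt.1 ha) hL2.le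
    linarith
  -- `32 L² ≤ a L⁴ / 2`
  have h32 : 32 * (L : ℝ) ^ 2 ≤ a * (L : ℝ) ^ 4 / 2 := by
    have h := mul_le_mul_of_nonneg_right h64 (show (0 : ℝ) ≤ (L : ℝ) ^ 2 / 2 by positivity)
    have e1 : (64 : ℝ) * ((L : ℝ) ^ 2 / 2) = 32 * (L : ℝ) ^ 2 := by ring
    have e2 : a * (L : ℝ) ^ 2 * ((L : ℝ) ^ 2 / 2) = a * (L : ℝ) ^ 4 / 2 := by ring
    rw [e1, e2] at h
    exact h
  -- `a L⁴ ≤ 64 L³ √S`, hence `a L ≤ 64 √S`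
  have hA : a * (L : ℝ) * (L : ℝ) ^ 3 ≤ 64 * Real.sqrt S * (L : ℝ) ^ 3 := by nlinarith
  have hB : a * (L : ℝ) ≤ 64 * Real.sqrt S := le_of_mul_le_mul_right hA hL3
  have hB0 : 0 ≤ a * (L : ℝ) := by positivity
  have hsq : (a * (L : ℝ)) ^ 2 ≤ (64 * Real.sqrt S) ^ 2 := pow_le_pow_left₀ hB0 hB 2
  have e : (64 * Real.sqrt S) ^ 2 = 4096 * S := by
    rw [mul_pow, Real.sq_sqrt hS0]
    norm_num
  rw [e] at hsq
  rw [div_le_iff₀ (by norm_num : (0 : ℝ) < 4096)]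
  nlinarith

end Smearing

end Literature.MathematicalPhysics.QuantumLattice
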